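import Summits.Ventures.HSemireg.WedgeHankelSubstitutionTorusOrder

/-!
# Venture HSemireg — THE NUMBER OF DISTINCT WEIGHTS OF A SEMISIMPLE SUBSTITUTION ON TH-7's CLASSES: with two distinct fixed nodes and non-zero weights `a = α+λ₁γ`, `b = α+λ₂γ`
# the weights `a^{n−p}b^p = a^n·r^p` (`r = b/a`) take exactly `min(n+1, ord r)` values, so `deg minpoly (SbC g) = min(n+1, ord r)` (`= n + 1`, i.e. `minpoly = charpoly`, iff
# `r` has infinite order or order `> n`) — K12's torus count for every split semisimple substitution

HONEST FRAMING. Part of the Lean index of the computation cell `pub-hsemireg` (seat p10 gen 22, Sunday typer «UNIFORM-IN-n»).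
Finite-dimensional EXTERIOR ALGEBRA + linear algebra + elementary group theory ONLY: no variety, no cohomology theory, no sheaf, no Ext group, no semiregularity map;
nothing here says that HC / HC_CM / HC_AV holds; no Literature fact is declared or used.  Custodian versions as in `WedgeHankelSiegelIdeal` (1/3) and `WedgeHankelFrameChange`;
the dictionary (a split semisimple `g ∈ GL₂` acts on `Sym^n` with weights `a^{n−p}b^p`; their number is governed by the order of the eigenvalue ratio) is QUOTED, never asserted.

WHAT IS IN THE TREE.  K2 (`…SemisimpleMinpoly`): `natDegree_minpoly_SbC_of_fixed_two` (`deg minpoly = #` distinct weights), `minpoly_SbC_of_fixed_two`; K12 (`…TorusOrder`):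
`pow_eq_pow_iff_modEq_orderOf`, `pow_injective_iff_orderOf`, `card_image_pow_eq` (`#{t^p : p ≤ n} = min(n+1, ord t)`), `card_image_pow_eq_of_orderOf_eq_zero`,
`natDegree_minpoly_SbC_torus` (the torus `SbC(1 0 0 t)` only); J17 `minpoly_SbC_eq_charpoly_of_fixed_two_of_injective`, I11 `charpoly_SbC_of_fixed_two`.  K2's header left «the
exact number of distinct weights `min(n+1, ord((α+λ₂γ)/(α+λ₁γ)))`» as NOT typed.  THIS FILE (namespace `Summit.Ventures.HSemireg.Wedge.HankelFrameChange` continued; imports K12):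
* §327 `weight_eq_pow_mul_ratio_pow` (`a^{n−p}b^p = a^n·(b/a)^p`, `a ≠ 0`), `image_weights_eq_image_ratio_pow`, **`card_image_weights_eq`** (`#` distinct weights `= #{r^p : p ≤ n}`),
  `card_image_weights_eq_min` (`= min(n+1, ord r)`, finite order), `card_image_weights_eq_succ` (`= n + 1`, `ord r = 0`), `weights_injective_iff` (distinct weights iff `ord r = 0 ∨
  n < ord r`).
* §328 **`natDegree_minpoly_SbC_of_fixed_two_eq_min`: `deg minpoly (SbC g) = min(n+1, ord r)`** (two distinct fixed nodes, `a, b ≠ 0`, `r = b/a` of finite order),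
  **`natDegree_minpoly_SbC_of_fixed_two_eq_succ`** (`ord r = 0`: `n + 1`), **`minpoly_SbC_eq_charpoly_iff_of_fixed_two`** (`minpoly = charpoly ⇔ ord r = 0 ∨ n < ord r`),
  `natDegree_minpoly_SbC_of_fixed_two_lt_iff` (`< n + 1 ⇔ 0 < ord r ≤ n`); the diagonal instances `natDegree_minpoly_SbC_diag_eq_min` / `_eq_succ`.
NOT typed here: a singular semisimple `g` (one weight `0`; J10/J18), eigenvalue multiplicities as residue-class counts (K18 + `pow_eq_pow_iff_modEq_orderOf`), anything Ext-side.
New names only.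
-/

open Module

namespace Summit.Ventures.HSemireg.Wedge.HankelFrameChange

open Summit.Ventures.HSemireg.Wedge Summit.Ventures.HSemireg.Wedge.Kunneth Summit.Ventures.HSemireg.Wedge.Hankel
  Summit.Ventures.HSemireg.Wedge.BasisFree Summit.Ventures.HSemireg.Wedge.HankelSiegel Summit.Ventures.HSemireg.Wedge.HankelSiegelIdeal
  Summit.Ventures.HSemireg.Wedge.KunnethKernel Summit.Ventures.HSemireg.Wedge.HankelRankOne Summit.Ventures.HSemireg.Wedge.KernelDuality

variable (K : Type*) [Field K] {n : ℕ}

/-! ## §327. The weights `a^{n−p}b^p` and the powers of the ratio `r = b/a` -/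

/-- `a ≠ 0`: `a^{n−p}b^p = a^n · (b/a)^p`. -/
theorem weight_eq_pow_mul_ratio_pow {a : K} (ha : a ≠ 0) (b : K) (p : Fin (n + 1)) : a ^ (n - (p : ℕ)) * b ^ (p : ℕ) = a ^ n * (b / a) ^ (p : ℕ) := by
  have hp : (p : ℕ) ≤ n := Nat.le_of_lt_succ p.2
  rw [div_pow, mul_div_assoc', eq_div_iff (pow_ne_zero _ ha), mul_assoc, mul_comm (b ^ (p : ℕ)), ← mul_assoc, ← pow_add, Nat.sub_add_cancel hp]

/-- the set of weights is the set of powers of the ratio, scaled by `a^n`. -/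
theorem image_weights_eq_image_ratio_pow [DecidableEq K] {a : K} (ha : a ≠ 0) (b : K) :
    Finset.univ.image (fun p : Fin (n + 1) => a ^ (n - (p : ℕ)) * b ^ (p : ℕ)) = (Finset.univ.image fun p : Fin (n + 1) => (b / a) ^ (p : ℕ)).image fun x => a ^ n * x := by
  rw [Finset.image_image]
  exact Finset.image_congr fun p _ => weight_eq_pow_mul_ratio_pow K ha b p

/-- **the number of distinct weights is the number of distinct powers `r^0, …, r^n` of the ratio** (`a ≠ 0`). -/
theorem card_image_weights_eq [DecidableEq K] {a : K} (ha : a ≠ 0) (b : K) :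
    (Finset.univ.image fun p : Fin (n + 1) => a ^ (n - (p : ℕ)) * b ^ (p : ℕ)).card = (Finset.univ.image fun p : Fin (n + 1) => (b / a) ^ (p : ℕ)).card := by
  rw [image_weights_eq_image_ratio_pow K ha b, Finset.card_image_of_injective _ (mul_right_injective₀ (pow_ne_zero n ha))]

/-- **finite order: `#` distinct weights `= min(n+1, ord(b/a))`** (`a, b ≠ 0`; K12). -/
theorem card_image_weights_eq_min [DecidableEq K] {a b : K} (ha : a ≠ 0) (hb : b ≠ 0) (hord : 0 < orderOf (b / a)) :
    (Finset.univ.image fun p : Fin (n + 1) => a ^ (n - (p : ℕ)) * b ^ (p : ℕ)).card = min (n + 1) (orderOf (b / a)) := by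
  rw [card_image_weights_eq K ha b, card_image_pow_eq K (div_ne_zero hb ha) hord]

/-- **infinite order (`ord(b/a) = 0`): all `n + 1` weights are distinct.** -/
theorem card_image_weights_eq_succ [DecidableEq K] {a b : K} (ha : a ≠ 0) (hb : b ≠ 0) (hord : orderOf (b / a) = 0) :
    (Finset.univ.image fun p : Fin (n + 1) => a ^ (n - (p : ℕ)) * b ^ (p : ℕ)).card = n + 1 := by
  rw [card_image_weights_eq K ha b, card_image_pow_eq_of_orderOf_eq_zero K (div_ne_zero hb ha) hord]

/-- **the weights are pairwise distinct iff `ord(b/a) = 0 ∨ n < ord(b/a)`** (`a, b ≠ 0`). -/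
theorem weights_injective_iff {a b : K} (ha : a ≠ 0) (hb : b ≠ 0) :
    (Function.Injective fun p : Fin (n + 1) => a ^ (n - (p : ℕ)) * b ^ (p : ℕ)) ↔ orderOf (b / a) = 0 ∨ n < orderOf (b / a) := by
  rw [← pow_injective_iff_orderOf K (div_ne_zero hb ha) n]
  have e : (fun p : Fin (n + 1) => a ^ (n - (p : ℕ)) * b ^ (p : ℕ)) = (fun x => a ^ n * x) ∘ fun p : Fin (n + 1) => (b / a) ^ (p : ℕ) :=
    funext fun p => weight_eq_pow_mul_ratio_pow K ha b p
  rw [e]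
  exact ⟨fun h => Function.Injective.of_comp h, fun h => (mul_right_injective₀ (pow_ne_zero n ha)).comp h⟩

/-! ## §328. The degree of the minimal polynomial of a split semisimple substitution -/

/-- **TWO DISTINCT FIXED NODES, NON-ZERO WEIGHTS `a = α+λ₁γ`, `b = α+λ₂γ`, `r = b/a` OF FINITE ORDER: `deg minpoly (SbC g) = min(n+1, ord r)`** on th-7's classes. -/
theorem natDegree_minpoly_SbC_of_fixed_two_eq_min {α β γ δ l₁ l₂ : K} (h₁₂ : l₁ ≠ l₂) (e₁ : β + l₁ * δ = l₁ * (α + l₁ * γ)) (e₂ : β + l₂ * δ = l₂ * (α + l₂ * γ))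
    (ha : α + l₁ * γ ≠ 0) (hb : α + l₂ * γ ≠ 0) (hord : 0 < orderOf ((α + l₂ * γ) / (α + l₁ * γ))) :
    (minpoly K (SbC K α β γ δ (n := n))).natDegree = min (n + 1) (orderOf ((α + l₂ * γ) / (α + l₁ * γ))) := by
  classical
  rw [natDegree_minpoly_SbC_of_fixed_two K h₁₂ e₁ e₂, card_image_weights_eq_min K ha hb hord]

/-- **… and `= n + 1` when `r` has infinite order.** -/
theorem natDegree_minpoly_SbC_of_fixed_two_eq_succ {α β γ δ l₁ l₂ : K} (h₁₂ : l₁ ≠ l₂) (e₁ : β + l₁ * δ = l₁ * (α + l₁ * γ)) (e₂ : β + l₂ * δ = l₂ * (α + l₂ * γ))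
    (ha : α + l₁ * γ ≠ 0) (hb : α + l₂ * γ ≠ 0) (hord : orderOf ((α + l₂ * γ) / (α + l₁ * γ)) = 0) :
    (minpoly K (SbC K α β γ δ (n := n))).natDegree = n + 1 := by
  classical
  rw [natDegree_minpoly_SbC_of_fixed_two K h₁₂ e₁ e₂, card_image_weights_eq_succ K ha hb hord]

/-- **`minpoly (SbC g) = charpoly (SbC g)` IFF `ord r = 0 ∨ n < ord r`** (two distinct fixed nodes, non-zero weights): the spectrum is multiplicity-free exactly then. -/
theorem minpoly_SbC_eq_charpoly_iff_of_fixed_two {α β γ δ l₁ l₂ : K} (h₁₂ : l₁ ≠ l₂) (e₁ : β + l₁ * δ = l₁ * (α + l₁ * γ)) (e₂ : β + l₂ * δ = l₂ * (α + l₂ * γ))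
    (ha : α + l₁ * γ ≠ 0) (hb : α + l₂ * γ ≠ 0) :
    minpoly K (SbC K α β γ δ (n := n)) = (SbC K α β γ δ (n := n)).charpoly ↔ orderOf ((α + l₂ * γ) / (α + l₁ * γ)) = 0 ∨ n < orderOf ((α + l₂ * γ) / (α + l₁ * γ)) := by
  classical
  rw [← weights_injective_iff K ha hb]
  constructor
  · intro h
    -- `deg minpoly = deg charpoly = n + 1` forces `n + 1` distinct weights
    have hdeg : (minpoly K (SbC K α β γ δ (n := n))).natDegree = n + 1 := by
      rw [h, LinearMap.charpoly_natDegree, finrank_eq_card_basis (spikeBasis K n), Fintype.card_fin]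
    rw [natDegree_minpoly_SbC_of_fixed_two K h₁₂ e₁ e₂] at hdeg
    have h2 : Set.InjOn (fun p : Fin (n + 1) => (α + l₁ * γ) ^ (n - (p : ℕ)) * (α + l₂ * γ) ^ (p : ℕ)) ↑(Finset.univ : Finset (Fin (n + 1))) :=
      Finset.card_image_iff.mp (by rw [hdeg, Finset.card_univ, Fintype.card_fin])
    exact fun p q e => h2 (Finset.mem_coe.mpr (Finset.mem_univ p)) (Finset.mem_coe.mpr (Finset.mem_univ q)) e
  · exact minpoly_SbC_eq_charpoly_of_fixed_two_of_injective K h₁₂ e₁ e₂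

/-- `deg minpoly < n + 1` iff `0 < ord r ≤ n`: the weights repeat exactly when the ratio has small finite order. -/
theorem natDegree_minpoly_SbC_of_fixed_two_lt_iff {α β γ δ l₁ l₂ : K} (h₁₂ : l₁ ≠ l₂) (e₁ : β + l₁ * δ = l₁ * (α + l₁ * γ)) (e₂ : β + l₂ * δ = l₂ * (α + l₂ * γ))
    (ha : α + l₁ * γ ≠ 0) (hb : α + l₂ * γ ≠ 0) :
    (minpoly K (SbC K α β γ δ (n := n))).natDegree < n + 1 ↔ 0 < orderOf ((α + l₂ * γ) / (α + l₁ * γ)) ∧ orderOf ((α + l₂ * γ) / (α + l₁ * γ)) ≤ n := by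
  classical
  rcases Nat.eq_zero_or_pos (orderOf ((α + l₂ * γ) / (α + l₁ * γ))) with h0 | hpos
  · rw [natDegree_minpoly_SbC_of_fixed_two_eq_succ K h₁₂ e₁ e₂ ha hb h0, h0]; omega
  · rw [natDegree_minpoly_SbC_of_fixed_two_eq_min K h₁₂ e₁ e₂ ha hb hpos]; omega

/-- the diagonal torus `SbC(a 0 0 d)`, `a, d ≠ 0`, `d/a` of finite order: `deg minpoly = min(n+1, ord(d/a))` (K12 is the case `a = 1`). -/
theorem natDegree_minpoly_SbC_diag_eq_min {a d : K} (ha : a ≠ 0) (hd : d ≠ 0) (hord : 0 < orderOf (d / a)) :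
    (minpoly K (SbC K a 0 0 d (n := n))).natDegree = min (n + 1) (orderOf (d / a)) := by
  classical
  rw [natDegree_minpoly_SbC_of_upper K (l₁ := 0) (by rw [zero_mul, zero_mul, add_zero]), card_image_weights_eq_min K ha hd hord]

/-- the diagonal torus with `d/a` of infinite order: `deg minpoly = n + 1`. -/
theorem natDegree_minpoly_SbC_diag_eq_succ {a d : K} (ha : a ≠ 0) (hd : d ≠ 0) (hord : orderOf (d / a) = 0) :
    (minpoly K (SbC K a 0 0 d (n := n))).natDegree = n + 1 := by
  classical
  rw [natDegree_minpoly_SbC_of_upper K (l₁ := 0) (by rw [zero_mul, zero_mul, add_zero]), card_image_weights_eq_succ K ha hd hord]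

end Summit.Ventures.HSemireg.Wedge.HankelFrameChange
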